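import Summits.BirchSwinnertonDyer.BirchSwinnertonDyer.Theorems.ResidualThetaTransportAtTwoThetaLayerLambdaCongruenceAtTwoCuspSpanRowInductionThree
import HarnessLib

/-!
# Route `ResidualThetaTransportAtTwo`, cruxes Kan⁺ (stmt-BirchSwinnertonDyer-20688) / node 27436 / 21437: ALL ODD ROWS ARE KILLED,
# (G‴)_N, and THE NODE `CuspSpanEvenAtTwo N` AT EVERY ODD LEVEL `N`

Cell `bsd-wall`, width seat `bsd-wall-rtt-p3-w2` g5 (2026-08-28), memo `Cruxes/ThetaLayerLambdaCongruenceAtTwo/Lines/birth-rows-allodd.md`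
(w4 g2) §4 + §1. THEOREMS ONLY; `--supports stmt-BirchSwinnertonDyer-20688`; BSD is not proved by this.

Inputs by name: the row character and its relations (`…CuspSpanRowConjugation`, `…CuspSpanRowRelations`, `…CuspSpanRowInduction`,
w4 g2), its values at every odd level incl. `3 ∣ N` (`…CuspSpanRowInductionThree`, this seat), and (G′)_N ⟸ (G‴)_N
(`cuspSpanEvenAtTwo_of_forall_b1_odd`, `…CuspSpanCharacterOdd`, w4 g2).
* §3 `F_eq_zero_of_isUnit'`, **`chi_eq_zero_row_step'`** — the induction step WITHOUT `3 ∤ N`: `N` odd, `χ` additive killing the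
  small-trace elements, the `|d| = 4^k` elements and the row `b = −1`, `m ≥ 3` odd, every row `b = −t` (`t` odd, `t < m`) killed
  ⟹ the row `b = −m` is killed; **`chi_eq_zero_of_b_neg_odd`** — every odd row is killed (strong induction from `B₁`).
* §4 `chi_eq_zero_of_forall_odd_rows` — parity: all odd rows killed ⟹ `χ ≡ 0` (`b` even ⟹ `a` odd ⟹ `γT` has odd `b`);
  **`chi_eq_zero_of_b1_odd`** — (G‴)_N at every odd `N`; **`cuspSpanEvenAtTwo_oddLevel : Odd N → CuspSpanEvenAtTwo N`** — the node
  (G′)_N at EVERY odd level, and `cuspSpanEvenAtTwo_of_not_two_dvd` (the `¬ 2 ∣ N` form of the route decl `CuspSpanEvenAtTwoOdd`,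
  item stmt-BirchSwinnertonDyer-27436).
The proof bodies of §3 are those of `…CuspSpanRowInduction` §3 with `exists_F_eq_zero_aux'` / `F_eq_zero_of_cast_eq_one'` in place of
the `3 ∤ N` versions (adapted, w4 g2).

References: [Rademacher1929] §1; [IrelandRosen1990] Ch. 3–4; [Pollack2003] Conj. 6.3.
-/

set_option autoImplicit false
set_option linter.dupNamespace false

noncomputable section

open scoped MatrixGroups

open CongruenceSubgroup

namespace Summit.BirchSwinnertonDyer.BirchSwinnertonDyer.Theorems.SignedMuAtTwo.Rows

variable {N : ℕ} {χ : Gamma0 N → ZMod 2}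

section Values

variable (hN : Odd N) (m : ℕ) (hm : Odd m)
  (hadd : ∀ γ δ : Gamma0 N, χ (γ * δ) = χ γ + χ δ)
  (hsmall : ∀ γ : Gamma0 N, ((γ : SL(2, ℤ)) 0 0 + (γ : SL(2, ℤ)) 1 1).natAbs ≤ 2 → χ γ = 0)
  (hkill : ∀ γ : Gamma0 N, (∃ k : ℕ, 1 ≤ k ∧ ((γ : SL(2, ℤ)) 1 1).natAbs = 4 ^ k) → χ γ = 0)
  (hB1 : ∀ β : Gamma0 N, (β : SL(2, ℤ)) 0 1 = -1 → χ β = 0)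
  (F : ZMod (m * N) → ZMod 2)
  (hF : ∀ γ : Gamma0 N, (γ : SL(2, ℤ)) 0 1 = -(m : ℤ) → F ((((γ : SL(2, ℤ)) 1 1 : ℤ) : ZMod (m * N))) = χ γ)
include hN hm hadd hsmall hkill hB1 hF

/-! ## §3. `F ≡ 0` on units; the row `b = −m` is killed — every odd level -/

/-- **`F ≡ 0` on the units of `ℤ/mN`** at every odd `N`, given that every odd row `b = −t`, `t < m`, is killed.
[cite: Pollack2003, Conj. 6.3] -/
theorem F_eq_zero_of_isUnit' (hm3 : 3 ≤ m)
    (IH : ∀ t : ℕ, Odd t → t < m → ∀ γ : Gamma0 N, (γ : SL(2, ℤ)) 0 1 = -(t : ℤ) → χ γ = 0)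
    (z : ZMod (m * N)) (hz : IsUnit z) : F z = 0 := by
  haveI : NeZero N := ⟨hN.pos.ne'⟩
  have hm0 : m ≠ 0 := hm.pos.ne'
  haveI : NeZero (m * N) := ⟨Nat.mul_ne_zero hm0 (NeZero.ne N)⟩
  haveI : NeZero m := ⟨hm0⟩
  set π := ZMod.castHom (dvd_mul_right m N) (ZMod m) with hπ
  set r : ℕ := (π z).val with hr
  have hrm : r < m := ZMod.val_lt _
  have hrcast : ((r : ℕ) : ZMod m) = π z := ZMod.natCast_zmod_val _
  have hru : IsUnit (π z) := hz.map π
  have hrcop : Nat.Coprime r m := by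
    have h := ZMod.val_coe_unit_coprime hru.unit
    rwa [IsUnit.unit_spec] at h
  have hr0 : r ≠ 0 := by
    intro h0
    have : Nat.Coprime 0 m := h0 ▸ hrcop
    rw [Nat.coprime_zero_left] at this
    omega
  -- the odd one of `r`, `m − r`
  obtain ⟨t, htodd, htm, htcop, hsign⟩ : ∃ t : ℕ, Odd t ∧ t < m ∧ Nat.Coprime t m ∧
      (π z = (t : ZMod m) ∨ π z = -(t : ZMod m)) := by
    rcases Nat.even_or_odd r with he | ho
    · refine ⟨m - r, ?_, by omega, ?_, Or.inr ?_⟩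
      · exact (Nat.odd_sub hrm.le).mpr ⟨fun _ ↦ he, fun _ ↦ hm⟩
      · exact (Nat.coprime_self_sub_left hrm.le).mpr hrcop
      · rw [← hrcast, Nat.cast_sub hrm.le, ZMod.natCast_self, zero_sub, neg_neg]
    · exact ⟨r, ho, hrm, hrcop, Or.inl hrcast.symm⟩
  obtain ⟨x, hxu, hFx, D, hD⟩ := exists_F_eq_zero_aux' hN m hadd hB1 F hF t htcop (IH t htodd htm)
  -- `t · π x = −1`
  have htx : (t : ZMod m) * π x = -1 := by
    have e := congrArg π hD
    rw [map_mul, map_natCast, map_intCast] at e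
    rw [e]; push_cast; rw [ZMod.natCast_self, mul_zero, zero_sub]
  have hFinv : F ((hxu.unit⁻¹ : (ZMod (m * N))ˣ) : ZMod (m * N)) = 0 := by
    rw [F_inv hN m hm hadd hsmall hkill F hF, IsUnit.unit_spec]; exact hFx
  have hxi : x * ((hxu.unit⁻¹ : (ZMod (m * N))ˣ) : ZMod (m * N)) = 1 := IsUnit.mul_val_inv hxu
  rcases hsign with hpos | hneg
  · -- `π z = t`: `π(−(z x)) = 1`
    have h1 : π (-(z * x)) = 1 := by rw [map_neg, map_mul, hpos, htx, neg_neg]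
    have h0 := F_eq_zero_of_cast_eq_one' hN m hm hadd hsmall hkill hB1 F hF (-(z * x)) ((hz.mul hxu).neg) h1
    have e : z = (-1) * (-(z * x)) * ((hxu.unit⁻¹ : (ZMod (m * N))ˣ) : ZMod (m * N)) := by
      rw [neg_mul_neg, one_mul, mul_assoc, hxi, mul_one]
    rw [e, F_mul hN m hm hadd hsmall hkill F hF _ _ ((isUnit_one.neg).mul ((hz.mul hxu).neg)) (Units.isUnit _),
      F_mul hN m hm hadd hsmall hkill F hF _ _ (isUnit_one.neg) ((hz.mul hxu).neg),
      F_neg_one hN m hm hadd hsmall hkill F hF, h0, hFinv, add_zero, add_zero]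
  · -- `π z = −t`: `π(z x) = 1`
    have h1 : π (z * x) = 1 := by rw [map_mul, hneg, neg_mul, htx, neg_neg]
    have h0 := F_eq_zero_of_cast_eq_one' hN m hm hadd hsmall hkill hB1 F hF (z * x) (hz.mul hxu) h1
    have e : z = (z * x) * ((hxu.unit⁻¹ : (ZMod (m * N))ˣ) : ZMod (m * N)) := by rw [mul_assoc, hxi, mul_one]
    rw [e, F_mul hN m hm hadd hsmall hkill F hF _ _ (hz.mul hxu) (Units.isUnit _), h0, hFinv, add_zero]

end Values

/-- **The induction step at EVERY odd level.** `N` odd; `χ` additive, killing the small-trace elements, the `|d| = 4^k`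
elements and the row `b = −1`; `m ≥ 3` odd; every row `b = −t` with `t` odd, `t < m` killed. Then the row `b = −m` is killed.
(`Rows.chi_eq_zero_row_step` without the hypothesis `3 ∤ N`.) [cite: Pollack2003, Conj. 6.3] -/
theorem chi_eq_zero_row_step' (hN : Odd N) (m : ℕ) (hm : Odd m) (hm3 : 3 ≤ m)
    (hadd : ∀ γ δ : Gamma0 N, χ (γ * δ) = χ γ + χ δ)
    (hsmall : ∀ γ : Gamma0 N, ((γ : SL(2, ℤ)) 0 0 + (γ : SL(2, ℤ)) 1 1).natAbs ≤ 2 → χ γ = 0)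
    (hkill : ∀ γ : Gamma0 N, (∃ k : ℕ, 1 ≤ k ∧ ((γ : SL(2, ℤ)) 1 1).natAbs = 4 ^ k) → χ γ = 0)
    (hB1 : ∀ β : Gamma0 N, (β : SL(2, ℤ)) 0 1 = -1 → χ β = 0)
    (IH : ∀ t : ℕ, Odd t → t < m → ∀ γ : Gamma0 N, (γ : SL(2, ℤ)) 0 1 = -(t : ℤ) → χ γ = 0) :
    ∀ γ : Gamma0 N, (γ : SL(2, ℤ)) 0 1 = -(m : ℤ) → χ γ = 0 := by
  classical
  haveI : NeZero N := ⟨hN.pos.ne'⟩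
  have hm0 : m ≠ 0 := hm.pos.ne'
  haveI : NeZero (m * N) := ⟨Nat.mul_ne_zero hm0 (NeZero.ne N)⟩
  -- the row character
  let F : ZMod (m * N) → ZMod 2 := fun r ↦ if h : IsUnit r then χ (Classical.choose (exists_b_neg_of_isUnit (N := N) m hm0 h)) else 0
  have hF : ∀ γ : Gamma0 N, (γ : SL(2, ℤ)) 0 1 = -(m : ℤ) → F ((((γ : SL(2, ℤ)) 1 1 : ℤ) : ZMod (m * N))) = χ γ := by
    intro γ hb
    have hdet := Matrix.SpecialLinearGroup.det_coe (γ : SL(2, ℤ))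
    rw [Matrix.det_fin_two, hb] at hdet
    obtain ⟨c, hc⟩ : (N : ℤ) ∣ (γ : SL(2, ℤ)) 1 0 := by
      have h := γ.2; rw [Gamma0_mem] at h; exact (ZMod.intCast_zmod_eq_zero_iff_dvd _ N).mp h
    rw [hc] at hdet
    have hu : IsUnit ((((γ : SL(2, ℤ)) 1 1 : ℤ) : ZMod (m * N))) := by
      refine (ZMod.coe_int_isUnit_iff_isCoprime _ (m * N)).mpr ?_
      push_cast
      exact ⟨c, (γ : SL(2, ℤ)) 0 0, by linear_combination hdet⟩
    have hs := Classical.choose_spec (exists_b_neg_of_isUnit (N := N) m hm0 hu)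
    simp only [F, dif_pos hu]
    exact chi_eq_of_b_neg_of_cast_eq hN m hm hadd hsmall hkill hs.1 hb hs.2
  intro γ hb
  rw [← hF γ hb]
  refine F_eq_zero_of_isUnit' hN m hm hadd hsmall hkill hB1 F hF hm3 IH _ ?_
  -- `d(γ)` is a unit mod `mN`
  have hdet := Matrix.SpecialLinearGroup.det_coe (γ : SL(2, ℤ))
  rw [Matrix.det_fin_two, hb] at hdet
  obtain ⟨c, hc⟩ : (N : ℤ) ∣ (γ : SL(2, ℤ)) 1 0 := by
    have h := γ.2; rw [Gamma0_mem] at h; exact (ZMod.intCast_zmod_eq_zero_iff_dvd _ N).mp h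
  rw [hc] at hdet
  refine (ZMod.coe_int_isUnit_iff_isCoprime _ (m * N)).mpr ?_
  push_cast
  exact ⟨c, (γ : SL(2, ℤ)) 0 0, by linear_combination hdet⟩

/-- **All odd rows are killed** (every odd `N`): by strong induction on the odd `m ≥ 1` from the row `b = −1`.
[cite: Pollack2003, Conj. 6.3] -/
theorem chi_eq_zero_of_b_neg_odd (hN : Odd N)
    (hadd : ∀ γ δ : Gamma0 N, χ (γ * δ) = χ γ + χ δ)
    (hsmall : ∀ γ : Gamma0 N, ((γ : SL(2, ℤ)) 0 0 + (γ : SL(2, ℤ)) 1 1).natAbs ≤ 2 → χ γ = 0)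
    (hkill : ∀ γ : Gamma0 N, (∃ k : ℕ, 1 ≤ k ∧ ((γ : SL(2, ℤ)) 1 1).natAbs = 4 ^ k) → χ γ = 0)
    (hB1 : ∀ β : Gamma0 N, (β : SL(2, ℤ)) 0 1 = -1 → χ β = 0)
    (m : ℕ) (hm : Odd m) : ∀ γ : Gamma0 N, (γ : SL(2, ℤ)) 0 1 = -(m : ℤ) → χ γ = 0 := by
  induction m using Nat.strong_induction_on with
  | _ m IHm =>
    intro γ hb
    by_cases hm3 : 3 ≤ m
    · exact chi_eq_zero_row_step' hN m hm hm3 hadd hsmall hkill hB1 (fun t ht htm ↦ IHm t htm ht) γ hb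
    · have hm1 : m = 1 := by obtain ⟨k, hk⟩ := hm; omega
      subst hm1
      exact hB1 γ (by rw [hb]; norm_num)


/-! ## §4. Parity: all odd rows killed ⟹ `χ ≡ 0`; (G‴)_N and the node (G′)_N at every odd level -/

/-- **Parity reduction.** If `χ` (additive, killing the small-trace elements) kills every odd row `b = −m`, then `χ ≡ 0`:
`b` odd and negative — the row itself; `b` odd and positive — `γ' = (d, −b; −Nc, a)` with `γ γ' = 1`; `b` even — then `a` is
odd (determinant) and `γ T` has `b' = a + b` odd, `χ T = 0`. [cite: Pollack2003, Conj. 6.3] -/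
theorem chi_eq_zero_of_forall_odd_rows [NeZero N]
    (hadd : ∀ γ δ : Gamma0 N, χ (γ * δ) = χ γ + χ δ)
    (hsmall : ∀ γ : Gamma0 N, ((γ : SL(2, ℤ)) 0 0 + (γ : SL(2, ℤ)) 1 1).natAbs ≤ 2 → χ γ = 0)
    (hrows : ∀ m : ℕ, Odd m → ∀ γ : Gamma0 N, (γ : SL(2, ℤ)) 0 1 = -(m : ℤ) → χ γ = 0) (γ : Gamma0 N) :
    χ γ = 0 := by
  -- odd `b`
  have hodd : ∀ γ : Gamma0 N, Odd ((γ : SL(2, ℤ)) 0 1) → χ γ = 0 := by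
    intro γ hb
    have hbabs : Odd ((γ : SL(2, ℤ)) 0 1).natAbs := Int.natAbs_odd.mpr hb
    rcases Int.natAbs_eq ((γ : SL(2, ℤ)) 0 1) with hpos | hneg
    · -- `b > 0`: `γ' = (d, −b; −Nc, a)`, `γ γ' = 1`
      have hdet := Matrix.SpecialLinearGroup.det_coe (γ : SL(2, ℤ))
      rw [Matrix.det_fin_two] at hdet
      have hc : (N : ℤ) ∣ (γ : SL(2, ℤ)) 1 0 := by
        have h := γ.2; rw [Gamma0_mem] at h; exact (ZMod.intCast_zmod_eq_zero_iff_dvd _ N).mp h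
      obtain ⟨γ', g00, g01, g10, g11⟩ := ThetaLayerLambdaCongruenceAtTwo.exists_gamma0_entries (N := N)
        ((γ : SL(2, ℤ)) 1 1) (-(γ : SL(2, ℤ)) 0 1) (-(γ : SL(2, ℤ)) 1 0) ((γ : SL(2, ℤ)) 0 0)
        (by linear_combination hdet) hc.neg_right
      have hγ' : χ γ' = 0 := hrows _ hbabs γ' (by rw [g01, ← hpos])
      have h00 : ((γ * γ' : Gamma0 N) : SL(2, ℤ)) 0 0 = 1 := by
        rw [show ((γ * γ' : Gamma0 N) : SL(2, ℤ)) 0 0 =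
            (γ : SL(2, ℤ)) 0 0 * (γ' : SL(2, ℤ)) 0 0 + (γ : SL(2, ℤ)) 0 1 * (γ' : SL(2, ℤ)) 1 0 from
          (Matrix.two_mul_expl ((γ : SL(2, ℤ)) : Matrix (Fin 2) (Fin 2) ℤ) ((γ' : SL(2, ℤ)) : Matrix (Fin 2) (Fin 2) ℤ)).1,
          g00, g10]
        linear_combination hdet
      have h11 : ((γ * γ' : Gamma0 N) : SL(2, ℤ)) 1 1 = 1 := by
        rw [gamma0_mul_apply_one_one', g01, g11]; linear_combination hdet
      have hprod : χ (γ * γ') = 0 := hsmall _ (by rw [h00, h11]; decide)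
      rw [hadd, hγ', add_zero] at hprod
      exact hprod
    · exact hrows _ hbabs γ hneg
  -- even `b`: pass to `γ T`
  rcases Int.even_or_odd ((γ : SL(2, ℤ)) 0 1) with he | ho
  · have hdet := Matrix.SpecialLinearGroup.det_coe (γ : SL(2, ℤ))
    rw [Matrix.det_fin_two] at hdet
    obtain ⟨T, t00, t01, -, t11⟩ :=
      ThetaLayerLambdaCongruenceAtTwo.exists_gamma0_entries (N := N) 1 1 0 1 (by ring) (dvd_zero _)
    have hT : χ T = 0 := hsmall T (by rw [t00, t11]; decide)
    have ha : Odd ((γ : SL(2, ℤ)) 0 0) := by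
      -- `a d − b c = 1` with `b` even ⟹ `a d` odd ⟹ `a` odd
      have h1 : Odd ((γ : SL(2, ℤ)) 0 0 * (γ : SL(2, ℤ)) 1 1) := by
        have e : (γ : SL(2, ℤ)) 0 0 * (γ : SL(2, ℤ)) 1 1 = (γ : SL(2, ℤ)) 0 1 * (γ : SL(2, ℤ)) 1 0 + 1 := by
          linear_combination hdet
        rw [e]; exact (he.mul_right _).add_odd odd_one
      exact (Int.odd_mul.mp h1).1
    have hb' : Odd (((γ * T : Gamma0 N) : SL(2, ℤ)) 0 1) := by
      rw [gamma0_mul_apply_zero_one, t01, t11, mul_one, mul_one]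
      exact ha.add_even he
    have h := hodd (γ * T) hb'
    rw [hadd, hT, add_zero] at h
    exact h
  · exact hodd γ ho

/-- **(G‴)_N at EVERY odd level `N`.** An additive `χ : Γ₀(N) → 𝔽₂` killing the elements of trace `0, ±1, ±2`, the elements with
lower-right entry `±4^k` (`k ≥ 1`) and the row `b = −1` vanishes identically (all odd rows by `chi_eq_zero_of_b_neg_odd`, then
parity). [cite: Pollack2003, Conj. 6.3] -/
theorem chi_eq_zero_of_b1_odd (hN : Odd N)
    (hadd : ∀ γ δ : Gamma0 N, χ (γ * δ) = χ γ + χ δ)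
    (hsmall : ∀ γ : Gamma0 N, ((γ : SL(2, ℤ)) 0 0 + (γ : SL(2, ℤ)) 1 1).natAbs ≤ 2 → χ γ = 0)
    (hkill : ∀ γ : Gamma0 N, (∃ k : ℕ, 1 ≤ k ∧ ((γ : SL(2, ℤ)) 1 1).natAbs = 4 ^ k) → χ γ = 0)
    (hB1 : ∀ β : Gamma0 N, (β : SL(2, ℤ)) 0 1 = -1 → χ β = 0) : ∀ γ : Gamma0 N, χ γ = 0 := by
  haveI : NeZero N := ⟨hN.pos.ne'⟩
  exact chi_eq_zero_of_forall_odd_rows hadd hsmall (fun m hm ↦ chi_eq_zero_of_b_neg_odd hN hadd hsmall hkill hB1 m hm)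

/-- **THE NODE (G′)_N AT EVERY ODD LEVEL `N`** (`SignedMuAtTwo.CuspSpanEvenAtTwo N`): every additive, period-invariant
`χ : Γ₀(N) → 𝔽₂` killing the `|d| = 4^k` elements is `ψ ∘ (lower-right entry mod N)` with `ψ` multiplicative on units — by
`cuspSpanEvenAtTwo_of_forall_b1_odd` (p638351: (G′)_N ⟸ (G‴)_N) and `chi_eq_zero_of_b1_odd`. Item stmt-BirchSwinnertonDyer-27436
`CuspSpanEvenAtTwoOdd` is `∀ N odd, CuspSpanEvenAtTwo N`. [cite: Pollack2003, Conj. 6.3] -/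
theorem cuspSpanEvenAtTwo_oddLevel (hN : Odd N) [NeZero N] : CuspSpanEvenAtTwo N :=
  cuspSpanEvenAtTwo_of_forall_b1_odd hN fun _ hadd hsmall hkill hB1 ↦ chi_eq_zero_of_b1_odd hN hadd hsmall hkill hB1

/-- **The node at every odd level, `¬ 2 ∣ N` form** (the shape of the route decl `CuspSpanEvenAtTwoOdd`). [cite: Pollack2003, Conj. 6.3] -/
theorem cuspSpanEvenAtTwo_of_not_two_dvd (N : ℕ) [NeZero N] (h2 : ¬ 2 ∣ N) : CuspSpanEvenAtTwo N :=
  cuspSpanEvenAtTwo_oddLevel (Nat.odd_iff.mpr (Nat.two_dvd_ne_zero.mp h2))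

end Summit.BirchSwinnertonDyer.BirchSwinnertonDyer.Theorems.SignedMuAtTwo.Rows

end
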